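import Literature.Analysis.ValidatedNumerics.AffineArithmetic
import Literature.Analysis.ValidatedNumerics.AffineArithmeticInv

/-!
# Cell-pressure certificate of the static route — the affine-arithmetic evaluator (computable side)
(crux stmt-QuantumFields-9734, line `Sketch`, stub `stub_heavyFrequencyGain`, Route B step B6; lead c3)

A `native_decide`-evaluable mirror of the real-side definitions of `…CellKappaDefs` (`nInv`, `planarWalk`, `propTrunc`,
`kappaOne`, `bubbleAbs`) in FIXED-POINT AFFINE ARITHMETIC over the three box coordinates `(M, s₀, s₁)`
(`Literature.Analysis.ValidatedNumerics.AForm`: centre, linear part in the noise symbols `ε₀, ε₁, ε₂ ∈ [−1,1]`, radius;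
scale `S`).  Complex numbers are pairs of affine forms (`CA`), `4 × 4` complex matrices are lists of 16 entries (`CM`), the
planar walk levels `F_j` are tables over the box `[−K, K]²` (`Array CM`, index `(a+K)(2K+1) + (b+K)`).  The checker
`cellKappaCheck` returns `true` iff, on every listed sub-box, the certified lower bound of `κ₁,J − b_{J,R}` (lower end of the
tadpole form minus the sum of the upper bounds `⌈√(re² + im²)⌉` of the bubble traces) is at least `S/4000`.
Soundness (`…CellKappaSound`) and the certificate (`…CellKappaCert`) are separate files.
-/

open Literature.Analysis.ValidatedNumerics

namespace Summit.QuantumFields.QCD.Cruxes.CriticalLineDiamagnetism.ChessboardCellGain.CellKappa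

/-! ### Complex affine forms -/

/-- A complex quantity as a pair of affine forms (real and imaginary part). -/
structure CA where
  /-- real part -/
  re : AForm
  /-- imaginary part -/
  im : AForm

namespace CA

/-- `0`. -/
def zero : CA := ⟨AForm.const 0, AForm.const 0⟩

/-- Sum. -/
def add (F G : CA) : CA := ⟨F.re.add G.re, F.im.add G.im⟩

/-- Difference. -/
def sub (F G : CA) : CA := ⟨F.re.sub G.re, F.im.sub G.im⟩

/-- Product at scale `S`: `(a+bi)(c+di) = (ac − bd) + (ad + bc)i`. -/
def mul (S : ℕ) (F G : CA) : CA :=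
  ⟨(F.re.mul S G.re).sub (F.im.mul S G.im), (F.re.mul S G.im).add (F.im.mul S G.re)⟩

/-- Product with a real affine form at scale `S`. -/
def mulReal (S : ℕ) (r : AForm) (F : CA) : CA := ⟨r.mul S F.re, r.mul S F.im⟩

/-- Product with the Gaussian integer `a + bi`: `(a+bi)(x+yi) = (ax − by) + (ay + bx)i`. -/
def mulGInt (a b : ℤ) (F : CA) : CA :=
  ⟨(F.re.mulInt a).sub (F.im.mulInt b), (F.im.mulInt a).add (F.re.mulInt b)⟩

/-- An upper bound, at scale `S`, of the absolute value of any complex number enclosed by `F`: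
`⌈√((|c_re| + rad_re)² + (|c_im| + rad_im)²)⌉ ≤ Nat.sqrt(…) + 1`. -/
def absUpper (F : CA) : ℕ :=
  let u : ℕ := F.re.c.natAbs + F.re.rad
  let v : ℕ := F.im.c.natAbs + F.im.rad
  Nat.sqrt (u * u + v * v) + 1

end CA

/-! ### `4 × 4` complex matrices -/

/-- A `4 × 4` complex matrix of affine forms, row-major list of its 16 entries. -/
abbrev CM := List CA

namespace CM

/-- Entry `(i, j)`. -/
def get (X : CM) (i j : ℕ) : CA := X.getD (4 * i + j) CA.zero

/-- The matrix with entries `f i j`. -/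
def ofFn (f : ℕ → ℕ → CA) : CM :=
  (List.range 4).flatMap fun i => (List.range 4).map fun j => f i j

/-- `0`. -/
def zero : CM := ofFn fun _ _ => CA.zero

/-- Sum. -/
def add (X Y : CM) : CM := ofFn fun i j => (X.get i j).add (Y.get i j)

/-- Product at scale `S`. -/
def mul (S : ℕ) (X Y : CM) : CM :=
  ofFn fun i j => ((CA.mul S (X.get i 0) (Y.get 0 j)).add (CA.mul S (X.get i 1) (Y.get 1 j))).add
    ((CA.mul S (X.get i 2) (Y.get 2 j)).add (CA.mul S (X.get i 3) (Y.get 3 j)))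

/-- Trace. -/
def trace (X : CM) : CA := ((X.get 0 0).add (X.get 1 1)).add ((X.get 2 2).add (X.get 3 3))

/-- The constant Gaussian-integer matrix with entries `(f i j).1 + (f i j).2 · i` (exactly representable at any scale `S`). -/
def ofGInt (S : ℕ) (f : ℕ → ℕ → ℤ × ℤ) : CM :=
  ofFn fun i j => ⟨AForm.const ((f i j).1 * S), AForm.const ((f i j).2 * S)⟩

/-- Left multiplication by a constant Gaussian-integer matrix (no rounding). -/
def gmulLeft (f : ℕ → ℕ → ℤ × ℤ) (X : CM) : CM :=
  ofFn fun i j => ((CA.mulGInt (f i 0).1 (f i 0).2 (X.get 0 j)).add (CA.mulGInt (f i 1).1 (f i 1).2 (X.get 1 j))).add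
    ((CA.mulGInt (f i 2).1 (f i 2).2 (X.get 2 j)).add (CA.mulGInt (f i 3).1 (f i 3).2 (X.get 3 j)))

/-- Right multiplication by a constant Gaussian-integer matrix (no rounding). -/
def gmulRight (X : CM) (f : ℕ → ℕ → ℤ × ℤ) : CM :=
  ofFn fun i j => ((CA.mulGInt (f 0 j).1 (f 0 j).2 (X.get i 0)).add (CA.mulGInt (f 1 j).1 (f 1 j).2 (X.get i 1))).add
    ((CA.mulGInt (f 2 j).1 (f 2 j).2 (X.get i 2)).add (CA.mulGInt (f 3 j).1 (f 3 j).2 (X.get i 3)))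

/-- Halving of every entry at scale `S` (for the projections `½(1 ∓ γ)`): `x/2` represented by `⌊c/2⌋` etc. with radius bump. -/
def half (X : CM) : CM :=
  ofFn fun i j => let e := X.get i j
    ⟨⟨e.re.c / 2, e.re.a.map (· / 2), (e.re.r + 1) / 2 + 1 + e.re.a.length⟩,
     ⟨e.im.c / 2, e.im.a.map (· / 2), (e.im.r + 1) / 2 + 1 + e.im.a.length⟩⟩

end CM

/-! ### The gamma matrices and the Wilson projections as Gaussian-integer tables -/

/-- Entries `(re, im)` of `euclideanGamma μ` (`…GrassmannIntegralProofs.euclideanGamma_zero/one/two/three`). -/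
def gammaTab (μ i j : ℕ) : ℤ × ℤ :=
  match μ with
  | 0 => -- !![0, 0, 0, -I; 0, 0, -I, 0; 0, I, 0, 0; I, 0, 0, 0]
    if (i, j) = (0, 3) ∨ (i, j) = (1, 2) then (0, -1) else if (i, j) = (2, 1) ∨ (i, j) = (3, 0) then (0, 1) else (0, 0)
  | 1 => -- !![0, 0, 0, -1; 0, 0, 1, 0; 0, 1, 0, 0; -1, 0, 0, 0]
    if (i, j) = (0, 3) ∨ (i, j) = (3, 0) then (-1, 0) else if (i, j) = (1, 2) ∨ (i, j) = (2, 1) then (1, 0) else (0, 0)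
  | 2 => -- !![0, 0, -I, 0; 0, 0, 0, I; I, 0, 0, 0; 0, -I, 0, 0]
    if (i, j) = (0, 2) ∨ (i, j) = (3, 1) then (0, -1) else if (i, j) = (1, 3) ∨ (i, j) = (2, 0) then (0, 1) else (0, 0)
  | _ => -- !![0, 0, 1, 0; 0, 0, 0, 1; 1, 0, 0, 0; 0, 1, 0, 0]
    if (i, j) = (0, 2) ∨ (i, j) = (1, 3) ∨ (i, j) = (2, 0) ∨ (i, j) = (3, 1) then (1, 0) else (0, 0)

/-- Entries of `2 P₋^μ = 1 − γ_μ` as Gaussian integers. -/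
def twoPMinusTab (μ i j : ℕ) : ℤ × ℤ :=
  ((if i = j then 1 else 0) - (gammaTab μ i j).1, -(gammaTab μ i j).2)

/-- Entries of `2 P₊^μ = 1 + γ_μ` as Gaussian integers. -/
def twoPPlusTab (μ i j : ℕ) : ℤ × ℤ :=
  ((if i = j then 1 else 0) + (gammaTab μ i j).1, (gammaTab μ i j).2)

/-! ### The inverse on-site block `N⁻¹` over the box coordinates -/

/-- `N⁻¹ = ρ⁻² (M·1 − i(s₀γ₀ + s₁γ₁))` from affine forms `FM, F₀, F₁` for `M, s₀, s₁`; `none` if `ρ²` is not certified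
positive.  Entry `(i,j)`: real part `M δ_ij + s₀ Im(γ₀)_ij + s₁ Im(γ₁)_ij`, imaginary part `−(s₀ Re(γ₀)_ij + s₁ Re(γ₁)_ij)`,
times `ρ⁻²`. -/
def nInvCM (S : ℕ) (FM F₀ F₁ : AForm) : Option CM :=
  match AForm.inv S (((FM.sq S).add (F₀.sq S)).add (F₁.sq S)) with
  | none => none
  | some invρ =>
    some (CM.ofFn fun i j =>
      let g0 := gammaTab 0 i j
      let g1 := gammaTab 1 i j
      let reP : AForm := ((if i = j then FM else AForm.const 0).add (F₀.mulInt g0.2)).add (F₁.mulInt g1.2)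
      let imP : AForm := ((F₀.mulInt g0.1).add (F₁.mulInt g1.1)).neg
      ⟨invρ.mul S reP, invρ.mul S imP⟩)

/-! ### Planar walk tables -/

/-- Index of the lattice point `(a, b)`, `|a|, |b| ≤ K`, in a table of size `(2K+1)²`. -/
def tabIdx (K : ℕ) (a b : ℤ) : ℕ := (a + K).toNat * (2 * K + 1) + (b + K).toNat

/-- Table lookup (zero outside the box). -/
def tabGet (K : ℕ) (T : Array CM) (a b : ℤ) : CM :=
  if |a| ≤ K ∧ |b| ≤ K then T.getD (tabIdx K a b) CM.zero else CM.zero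

/-- Level `0`: `F₀(z) = δ_{z,0} N⁻¹`. -/
def level0 (K : ℕ) (nI : CM) : Array CM :=
  Array.ofFn fun idx : Fin ((2 * K + 1) * (2 * K + 1)) =>
    let a : ℤ := (idx.val / (2 * K + 1) : ℕ) - (K : ℤ)
    let b : ℤ := (idx.val % (2 * K + 1) : ℕ) - (K : ℤ)
    if a = 0 ∧ b = 0 then nI else CM.zero

/-- One level of the recursion `F_{j+1}(z) = N⁻¹ [P₋²F_j(z+e₂) + P₊²F_j(z−e₂) + P₋³F_j(z+e₃) + P₊³F_j(z−e₃)]`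
(the projections enter as `½ ·` the Gaussian-integer tables of `1 ∓ γ`). -/
def levelStep (S K : ℕ) (nI : CM) (T : Array CM) : Array CM :=
  Array.ofFn fun idx : Fin ((2 * K + 1) * (2 * K + 1)) =>
    let a : ℤ := (idx.val / (2 * K + 1) : ℕ) - (K : ℤ)
    let b : ℤ := (idx.val % (2 * K + 1) : ℕ) - (K : ℤ)
    let acc : CM :=
      ((CM.gmulLeft (twoPMinusTab 2) (tabGet K T (a + 1) b)).add (CM.gmulLeft (twoPPlusTab 2) (tabGet K T (a - 1) b))).add
        ((CM.gmulLeft (twoPMinusTab 3) (tabGet K T a (b + 1))).add (CM.gmulLeft (twoPPlusTab 3) (tabGet K T a (b - 1))))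
    CM.mul S nI (CM.half acc)

/-- The truncated propagator table `g_J = Σ_{j ≤ J} F_j` over the box `[−K, K]²` (pair: last level, running sum). -/
def propTable (S K : ℕ) (nI : CM) : ℕ → Array CM × Array CM
  | 0 => (level0 K nI, level0 K nI)
  | j + 1 =>
    let prev := propTable S K nI j
    let nxt := levelStep S K nI prev.1
    (nxt, Array.ofFn fun idx : Fin ((2 * K + 1) * (2 * K + 1)) => (prev.2.getD idx.val CM.zero).add (nxt.getD idx.val CM.zero))

/-! ### The certified quantities on one sub-box -/

/-- The first-order hop blocks of the checkerboard link based at `(a, b)` as (position, position, ±, which projection):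
`((a,b), (a+1,b), −σ, P₋²)` and `((a+1,b), (a,b), σ, P₊²)`, `σ = (−1)^a`; encoded as `(z, x, sign, isMinus)`. -/
def linkBlocksE (l : ℤ × ℤ) : List ((ℤ × ℤ) × (ℤ × ℤ) × ℤ × Bool) :=
  let σ : ℤ := if l.1 % 2 = 0 then 1 else -1
  [((l.1, l.2), (l.1 + 1, l.2), -σ, true), ((l.1 + 1, l.2), (l.1, l.2), σ, false)]

/-- The partner links within `ℓ¹`-distance `R` (same enumeration as `nearLinks` of the definitions file). -/
def nearLinksE (R : ℕ) (l : ℤ × ℤ) : List (ℤ × ℤ) :=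
  ((List.range (2 * R + 1)).flatMap fun i => (List.range (2 * R + 1)).filterMap fun k =>
    let a : ℤ := l.1 + i - R
    let b : ℤ := l.2 + k - R
    if b % 2 ≠ 0 ∧ |a - l.1| + |b - l.2| ≤ R then some (a, b) else none)

/-- `g B` for a hop block `B = ± P∓²` (sign and halving applied to `g (1 ∓ γ₂)`). -/
def applyBlock (g : CM) (sgn : ℤ) (isMinus : Bool) : CM :=
  let tab := if isMinus then twoPMinusTab 2 else twoPPlusTab 2
  CM.half (CM.gmulRight g fun i j => (sgn * (tab i j).1, sgn * (tab i j).2))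

/-- Certified bounds on one sub-box given by affine forms `FM, F₀, F₁` (scale `S`, box half-width `K` for the tables):
`some (κlo, bhi)` with `κ₁,J · S ≥ κlo` and `b_{J,R} · 4 · S ≤ bhi`, or `none` if `ρ²` could not be inverted. -/
def boundsOnBox (S K J R : ℕ) (FM F₀ F₁ : AForm) : Option (ℤ × ℕ) :=
  match nInvCM S FM F₀ F₁ with
  | none => none
  | some nI =>
    let g := (propTable S K nI J).2
    let gz := fun z : ℤ × ℤ => tabGet K g z.1 z.2
    -- tadpole: −Re tr[g(1,0) P₋²]
    let tad : CA := (applyBlock (gz (1, 0)) 1 true).trace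
    let κlo : ℤ := -(tad.re.c + tad.re.rad)
    -- bubble
    let cell : List (ℤ × ℤ) := [(0, 1), (1, 1)]
    let bhi : ℕ := (cell.map fun l => ((linkBlocksE l).map fun b₂ =>
      ((nearLinksE R l).map fun l' => ((linkBlocksE l').map fun b₁ =>
        let g₁ := gz (b₂.2.1.1 - b₁.1.1, b₂.2.1.2 - b₁.1.2)
        let g₂ := gz (b₁.2.1.1 - b₂.1.1, b₁.2.1.2 - b₂.1.2)
        (CM.mul S (applyBlock g₁ b₁.2.2.1 b₁.2.2.2) (applyBlock g₂ b₂.2.2.1 b₂.2.2.2)).trace.absUpper).sum).sum).sum).sum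
    some (κlo, bhi)

/-- A sub-box: centres and half-widths of `M, s₀, s₁` as rationals. -/
structure SubBox where
  /-- centre of `M` -/
  cM : ℚ
  /-- half-width of `M` -/
  wM : ℚ
  /-- centre of `s₀` -/
  c0 : ℚ
  /-- half-width of `s₀` -/
  w0 : ℚ
  /-- centre of `s₁` -/
  c1 : ℚ
  /-- half-width of `s₁` -/
  w1 : ℚ

/-- The affine form of a box coordinate with centre `c` and half-width `w` on the noise symbol `j` (rounded inward-safe:
centre `⌊cS⌋`, coefficient `⌈wS⌉`, radius `1`). -/
def boxVar (S : ℕ) (c w : ℚ) (j : ℕ) : AForm :=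
  ⟨⌊c * S⌋, List.replicate j 0 ++ [⌈w * S⌉], 1⟩

/-- The check on one sub-box: `κlo − bhi/4 ≥ S/4000`, i.e. `4 κlo − bhi ≥ S/1000` in integers (`4000 ∣`-free form:
`1000 * (4 κlo − bhi) ≥ S`). -/
def checkSubBox (S K J R : ℕ) (B : SubBox) : Bool :=
  match boundsOnBox S K J R (boxVar S B.cM B.wM 0) (boxVar S B.c0 B.w0 1) (boxVar S B.c1 B.w1 2) with
  | none => false
  | some (κlo, bhi) => decide ((S : ℤ) ≤ 1000 * (4 * κlo - (bhi : ℤ)))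

/-- The list of sub-boxes covering `M ∈ [589/100, 61/10]`, `s₀, s₁ ∈ [−1/10, 1/10]`: `nM × ns × ns` equal pieces. -/
def subBoxes (nM ns : ℕ) : List SubBox :=
  (List.range nM).flatMap fun i => (List.range ns).flatMap fun k => (List.range ns).map fun l =>
    let wM : ℚ := (61 / 10 - 589 / 100) / (2 * nM)
    let ws : ℚ := (1 / 10) / ns
    ⟨589 / 100 + (2 * i + 1) * wM, wM, -1 / 10 + (2 * k + 1) * ws, ws, -1 / 10 + (2 * l + 1) * ws, ws⟩

/-- **The checker**: every sub-box passes. -/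
def cellKappaCheck (S K J R nM ns : ℕ) : Bool := (subBoxes nM ns).all fun B => checkSubBox S K J R B

/-- Registered anchor theorem of this definitions file: the check is monotone in nothing — a closed sanity statement:
every sub-box of the standard cover has the prescribed half-widths. -/
theorem cellKappaEval_anchor : ∀ (nM ns : ℕ) (B : SubBox), B ∈ subBoxes nM ns → B.wM = (61 / 10 - 589 / 100) / (2 * nM) ∧ B.w0 = (1 / 10) / ns ∧ B.w1 = (1 / 10) / ns := by
  intro nM ns B hB
  simp only [subBoxes, List.mem_flatMap, List.mem_map] at hB
  obtain ⟨i, -, k, -, l, -, rfl⟩ := hB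
  exact ⟨rfl, rfl, rfl⟩

end Summit.QuantumFields.QCD.Cruxes.CriticalLineDiamagnetism.ChessboardCellGain.CellKappa
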